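import Literature.NumberTheory.Transcendental.CurvePeriodsEllipticLiftCalculusProofs
import HarnessLib

/-!
# Periods of curve type on an elliptic curve, X: lifts as data, algebraic logarithms, ℤ-linearity

Companion of `Literature/NumberTheory/Transcendental/CurvePeriods.lean` (Huber–Wüstholz 2022,
Thm. 13.3 (2), rendered on explicit period symbols `(Z, ω, γ)` with the elementary relations
(R1)–(R5)) and of `CurvePeriodsEllipticLiftCalculusProofs.lean` (the calculus of lifted symbols on
`E_L : y² = x³ − (g₂/4)x − g₃/4`). This file packages lifts as data and proves the **ℤ-linearity
of the lifted symbols `U(w) = Sym(t₀ ↝ t₀ + w)` in the displacement `w`** at a generic algebraic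
base point `t₀` — the symbol-level form of the group law of `E_L` (functoriality (R4) along
translations, `CurvePeriodsEllipticTranslationProofs.lean`), as needed to pass from arbitrary
paths with algebraic end points to a `ℤ`-basis of their lifted displacements:

* `Ell.LiftData L a b` — a `C¹` lift `g : [0,1] → ℂ ∖ Λ` from `a` to `b` between algebraic
  points, with `path = φ ∘ g`, `sym = (E_L, ω, φ∘g)`; `nonempty`, `const`, `cast`, `shift`;
  the calculus restated: `span_sub` (lift invariance), `span_add`, `span_self`, `span_rev`,
  `span_sub_of_mem` (lattice shifts), `span_translate_theta0/1` (translation by an algebraic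
  point), `evalCombination_sym_theta0/1` (periods `2(b − a)`, `−2(ζ(b) − ζ(a))`);
* `Ell.AlgLog` — algebraic logarithms (`z ∈ Λ` or `φ(z)` algebraic) form a subgroup of `ℂ`
  (`AlgLog.add`: periodicity, chord law `IsAlgPt.add_of_ne`, tangent law `IsAlgPt.two_mul`;
  `neg`, `sub`, `zsmul`, `sum`);
* `Ell.exists_generic_algPt` — for every finite `B ⊂ ℂ` there is an algebraic (torsion) point
  `t₀ ∉ B + Λ` (pigeonhole on the `4ᵏ` incongruent vertices of the torsion grid `G_k`);
* `Ell.zadd`, `Ell.zneg`, `Ell.znsmul`, `Ell.zzsmul`, `Ell.zexpand` — for algebraic logarithms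
  `w, w′, m_l` and integers `n_l` there is a finite exceptional set `B` such that for every
  algebraic base point `t₀ ∉ B + Λ` and ALL lifts,
  `U(w + w′) ∼ U(w) + U(w′)`, `U(−m) ∼ −U(m)`, `U(z·m) ∼ z·U(m)`,
  **`U(Σ n_l m_l) ∼ Σ n_l U(m_l)`** for `θ₀`, and the same for `θ₁` up to algebraic multiples of
  `𝟙` (translation by `w` directly — `t₀` is chosen after the data — or a lattice shift).

## References

* A. Huber, G. Wüstholz, *Transcendence and Linear Relations of 1-Periods*, Cambridge Tracts in
  Mathematics 227, CUP 2022 [HuberWustholz2022]: §3.3.1 (pp. 42–44), §13.1 (B) (p. 120),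
  §18.1 (p. 160), Thm. 13.3 (2) (p. 121).
-/

noncomputable section

open scoped BigOperators
open scoped PeriodPair
open scoped Topology
open MvPolynomial Set Complex Filter Metric

namespace Literature.NumberTheory.Transcendental

namespace CurvePeriods

set_option quotPrecheck false in
/-- Membership in the `ℚ̄`-span of the elementary relations, in the format of the conclusion of
`HuberWustholzCurvePeriods`. -/
local notation "InSpan" c:max => ∃ (k : ℕ) (ρ : Fin k → (PeriodSymbol →₀ ℂ)) (a : Fin k → ℂ),
  (∀ l, IsElementaryRelation (ρ l)) ∧ (∀ l, IsAlgebraic ℚ (a l)) ∧ c = ∑ l, a l • ρ l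

namespace Ell

variable (L : PeriodPair)

/-! ### Lifts as data -/

/-- **A `C¹` lift from `a` to `b`**: a `C¹` map `g : ℝ → ℂ` with `g(0) = a`, `g(1) = b` whose
values on `[0,1]` avoid `Λ`, between algebraic points `φ(a)`, `φ(b)` of `E_L`. [folklore] -/
structure LiftData (a b : ℂ) where
  /-- The lift. -/
  g : ℝ → ℂ
  /-- It is `C¹`. -/
  contDiff : ContDiff ℝ 1 g
  /-- It avoids the lattice on `[0,1]`. -/
  avoid : ∀ t ∈ Icc (0 : ℝ) 1, g t ∉ L.lattice
  /-- It starts at `a`. -/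
  start : g 0 = a
  /-- It ends at `b`. -/
  stop : g 1 = b
  /-- `φ(a)` is an algebraic point. -/
  alg_start : IsAlgPt L a
  /-- `φ(b)` is an algebraic point. -/
  alg_stop : IsAlgPt L b

namespace LiftData

variable {L} {a b c : ℂ}

/-- [folklore] -/
theorem alg0 (D : LiftData L a b) : IsAlgPt L (D.g 0) := by rw [D.start]; exact D.alg_start

/-- [folklore] -/
theorem alg1 (D : LiftData L a b) : IsAlgPt L (D.g 1) := by rw [D.stop]; exact D.alg_stop

/-- The path `φ ∘ g` on `E_L`. [folklore] -/
def path (D : LiftData L a b) : CurvePath (curve L) :=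
  liftPath L D.g D.contDiff D.avoid D.alg0 D.alg1

/-- [folklore] -/
@[simp] theorem path_toFun (D : LiftData L a b) (t : ℝ) : D.path.toFun t = phi L (D.g t) := rfl

/-- **Lifts exist** between any two algebraic points (`exists_path_avoiding_translates`).
[folklore] -/
theorem nonempty (ha : IsAlgPt L a) (hb : IsAlgPt L b) : Nonempty (LiftData L a b) := by
  classical
  obtain ⟨g, hg, h0, h1, hS⟩ := exists_path_avoiding_translates L ({0} : Finset ℂ) (a := a) (b := b)
    (fun c hc => by rw [Finset.mem_singleton] at hc; subst hc; simpa using ha.1)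
    (fun c hc => by rw [Finset.mem_singleton] at hc; subst hc; simpa using hb.1)
  exact ⟨⟨g, hg, fun t ht => by simpa using hS t ht 0 (by simp), h0, h1, ha, hb⟩⟩

/-- The constant lift. [folklore] -/
def const (ha : IsAlgPt L a) : LiftData L a a :=
  ⟨fun _ => a, contDiff_const, fun _ _ => ha.1, rfl, rfl, ha, ha⟩

/-- Transport of a lift along equalities of its end points. [folklore] -/
def cast (D : LiftData L a b) {a' b' : ℂ} (ha : a = a') (hb : b = b') : LiftData L a' b' :=
  ⟨D.g, D.contDiff, D.avoid, D.start.trans ha, D.stop.trans hb, ha ▸ D.alg_start, hb ▸ D.alg_stop⟩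

/-- [folklore] -/
@[simp] theorem path_cast (D : LiftData L a b) {a' b' : ℂ} (ha : a = a') (hb : b = b') :
    (D.cast ha hb).path = D.path := rfl

/-- Shift of a lift by a lattice vector (the same path on `E_L`). [folklore] -/
def shift (D : LiftData L a b) (l : ℂ) (hl : l ∈ L.lattice) : LiftData L (a + l) (b + l) :=
  ⟨fun t => D.g t + l, D.contDiff.add contDiff_const,
    fun t ht h => D.avoid t ht (by simpa using sub_mem h hl),
    by rw [D.start], by rw [D.stop], D.alg_start.add_of_mem hl, D.alg_stop.add_of_mem hl⟩

/-- [folklore] -/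
theorem path_shift (D : LiftData L a b) (l : ℂ) (hl : l ∈ L.lattice) :
    (D.shift l hl).path = D.path :=
  CurvePath.eq_of_toFun_eq fun t => by simp [shift, path, phi_add_of_mem L _ hl]

section Sym

variable (h₂ : IsAlgebraic ℚ L.g₂) (h₃ : IsAlgebraic ℚ L.g₃)

/-- **The symbol `(E_L, ω, φ∘g)` of a lift.** [folklore] -/
def sym (D : LiftData L a b) (ω : Fin 2 → MvPolynomial (Fin 2) ℂ) (hω : ∀ k, HasAlgCoeffs (ω k)) :
    PeriodSymbol →₀ ℂ :=
  Finsupp.single (⟨curve L, smooth L h₂ h₃, ω, hω, D.path⟩ : PeriodSymbol) (1 : ℂ)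

/-- [folklore] -/
theorem sym_cast (D : LiftData L a b) {a' b' : ℂ} (ha : a = a') (hb : b = b')
    (ω : Fin 2 → MvPolynomial (Fin 2) ℂ) (hω : ∀ k, HasAlgCoeffs (ω k)) :
    (D.cast ha hb).sym h₂ h₃ ω hω = D.sym h₂ h₃ ω hω := rfl

/-- [folklore] -/
theorem sym_shift (D : LiftData L a b) (l : ℂ) (hl : l ∈ L.lattice)
    (ω : Fin 2 → MvPolynomial (Fin 2) ℂ) (hω : ∀ k, HasAlgCoeffs (ω k)) :
    (D.shift l hl).sym h₂ h₃ ω hω = D.sym h₂ h₃ ω hω := by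
  rw [sym, sym, path_shift]

/-- The period of the `θ₀`-symbol of a lift: `2(b − a)`. [cite: HuberWustholz2022, §18.1 (p. 160)] -/
theorem evalCombination_sym_theta0 (D : LiftData L a b) :
    evalCombination (D.sym h₂ h₃ (theta0 L) (hasAlgCoeffs_theta0 L h₂ h₃)) = 2 * (b - a) := by
  rw [sym, evalCombination_single, one_mul, path, period_theta0_liftPath L h₂ h₃, D.start, D.stop]

/-- The period of the `θ₁`-symbol of a lift: `−2(ζ(b) − ζ(a))`. [cite: HuberWustholz2022, §18.1 (p. 160)] -/
theorem evalCombination_sym_theta1 (D : LiftData L a b) :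
    evalCombination (D.sym h₂ h₃ (theta1 L) (hasAlgCoeffs_theta1 L h₂ h₃)) =
      -2 * (L.weierstrassZeta b - L.weierstrassZeta a) := by
  rw [sym, evalCombination_single, one_mul, path, period_theta1_liftPath L h₂ h₃, D.start, D.stop]

/-- **Lift invariance**: two lifts with the same end points have the same symbol modulo the
elementary relations. [cite: HuberWustholz2022, §3.3.1 (pp. 42–44)] -/
theorem span_sub (D D' : LiftData L a b) (ω : Fin 2 → MvPolynomial (Fin 2) ℂ)
    (hω : ∀ k, HasAlgCoeffs (ω k)) :
    InSpan (D.sym h₂ h₃ ω hω - D'.sym h₂ h₃ ω hω) :=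
  span_liftPath_sub_liftPath L h₂ h₃ D.contDiff D'.contDiff D.avoid D'.avoid D.alg0 D.alg1
    D'.alg0 D'.alg1 (by rw [D.start, D'.start]) (by rw [D.stop, D'.stop]) ω hω

/-- **Additivity** `Sym(a ↝ c) ∼ Sym(a ↝ b) + Sym(b ↝ c)`. [cite: HuberWustholz2022, §3.3.1 (pp. 42–44)] -/
theorem span_add (D₀₂ : LiftData L a c) (D₀₁ : LiftData L a b) (D₁₂ : LiftData L b c)
    (ω : Fin 2 → MvPolynomial (Fin 2) ℂ) (hω : ∀ k, HasAlgCoeffs (ω k)) :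
    InSpan (D₀₂.sym h₂ h₃ ω hω - D₀₁.sym h₂ h₃ ω hω - D₁₂.sym h₂ h₃ ω hω) :=
  span_lift_add L h₂ h₃ D₀₂.contDiff D₀₁.contDiff D₁₂.contDiff D₀₂.avoid D₀₁.avoid D₁₂.avoid
    D₀₂.alg0 D₀₂.alg1 D₀₁.alg0 D₀₁.alg1 D₁₂.alg0 D₁₂.alg1 (by rw [D₀₁.start, D₀₂.start])
    (by rw [D₁₂.start, D₀₁.stop]) (by rw [D₁₂.stop, D₀₂.stop]) ω hω

/-- **`Sym(a ↝ a) ∼ 0`.** [cite: HuberWustholz2022, §3.3.1 (p. 44)] -/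
theorem span_self (D : LiftData L a a) (ω : Fin 2 → MvPolynomial (Fin 2) ℂ)
    (hω : ∀ k, HasAlgCoeffs (ω k)) : InSpan (D.sym h₂ h₃ ω hω) :=
  span_lift_self L h₂ h₃ D.contDiff D.avoid D.alg0 D.alg1 (by rw [D.stop, D.start]) ω hω

/-- **`Sym(a ↝ b) + Sym(b ↝ a) ∼ 0`.** [cite: HuberWustholz2022, §3.3.1 (p. 42)] -/
theorem span_rev (D : LiftData L a b) (D' : LiftData L b a) (ω : Fin 2 → MvPolynomial (Fin 2) ℂ)
    (hω : ∀ k, HasAlgCoeffs (ω k)) : InSpan (D.sym h₂ h₃ ω hω + D'.sym h₂ h₃ ω hω) :=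
  span_lift_add_lift_rev L h₂ h₃ D.contDiff D'.contDiff D.avoid D'.avoid D.alg0 D.alg1 D'.alg0
    D'.alg1 (by rw [D'.start, D.stop]) (by rw [D'.stop, D.start]) ω hω

/-- **Lattice shifts do not change the symbol**: `Sym(a + l ↝ b + l) ∼ Sym(a ↝ b)`, `l ∈ Λ`.
[folklore] -/
theorem span_sub_of_mem (D : LiftData L a b) {l : ℂ} (hl : l ∈ L.lattice)
    (D' : LiftData L (a + l) (b + l)) (ω : Fin 2 → MvPolynomial (Fin 2) ℂ)
    (hω : ∀ k, HasAlgCoeffs (ω k)) : InSpan (D'.sym h₂ h₃ ω hω - D.sym h₂ h₃ ω hω) := by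
  rw [← D.sym_shift h₂ h₃ l hl]
  exact span_sub h₂ h₃ D' (D.shift l hl) ω hω

/-- **Translation invariance, `θ₀`**: `Sym_{θ₀}(a + v ↝ b + v) ∼ Sym_{θ₀}(a ↝ b)` for an
algebraic point `φ(v)` and `a, b ∉ ±v + Λ`. [cite: HuberWustholz2022, §13.1 (B) (p. 120), §18.1 (p. 160)] -/
theorem span_translate_theta0 {v : ℂ} (hv : IsAlgPt L v) (D : LiftData L a b)
    (D' : LiftData L (a + v) (b + v)) (ha : ℘[L] a ≠ ℘[L] v) (hb : ℘[L] b ≠ ℘[L] v) :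
    InSpan (D'.sym h₂ h₃ (theta0 L) (hasAlgCoeffs_theta0 L h₂ h₃) -
      D.sym h₂ h₃ (theta0 L) (hasAlgCoeffs_theta0 L h₂ h₃)) :=
  span_lift_translate_theta0 L h₂ h₃ hv D.contDiff D'.contDiff D.avoid D'.avoid D.alg0 D.alg1
    D'.alg0 D'.alg1 (by rw [D'.start, D.start]) (by rw [D'.stop, D.stop])
    (by rw [D.start]; exact ha) (by rw [D.stop]; exact hb)

/-- **Translation invariance, `θ₁`**, up to the algebraic constant `R(ψ_v(b)) − R(ψ_v(a))`.
[cite: HuberWustholz2022, §13.1 (B) (p. 120), §18.1 (p. 160)] -/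
theorem span_translate_theta1 {v : ℂ} (hv : IsAlgPt L v) (D : LiftData L a b)
    (D' : LiftData L (a + v) (b + v)) (ha : ℘[L] a ≠ ℘[L] v) (hb : ℘[L] b ≠ ℘[L] v) :
    InSpan (D'.sym h₂ h₃ (theta1 L) (hasAlgCoeffs_theta1 L h₂ h₃) -
      D.sym h₂ h₃ (theta1 L) (hasAlgCoeffs_theta1 L h₂ h₃) -
      (eval (psiT L v b) (rPolyT L v) - eval (psiT L v a) (rPolyT L v)) •
        Finsupp.single PeriodSymbol.unit (1 : ℂ)) := by
  have h := span_lift_translate_theta1 L h₂ h₃ hv D.contDiff D'.contDiff D.avoid D'.avoid D.alg0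
    D.alg1 D'.alg0 D'.alg1 (by rw [D'.start, D.start]) (by rw [D'.stop, D.stop])
    (by rw [D.start]; exact ha) (by rw [D.stop]; exact hb)
  rw [D.start, D.stop] at h
  exact h

end Sym

end LiftData

/-! ### The group of algebraic logarithms -/

/-- **Algebraic logarithms**: `z ∈ ℂ` lies over an algebraic point of the complete curve, i.e.
`z ∈ Λ` (the point `O`) or `φ(z)` is an algebraic point of `E_L`. They form a subgroup of `ℂ`
(the group law is defined over `ℚ̄`). [folklore] -/
def AlgLog (z : ℂ) : Prop := z ∈ L.lattice ∨ IsAlgPt L z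

variable {L}

/-- [folklore] -/
theorem AlgLog.isAlgPt {z : ℂ} (h : AlgLog L z) (hz : z ∉ L.lattice) : IsAlgPt L z :=
  h.resolve_left hz

/-- [folklore] -/
theorem algLog_of_mem {z : ℂ} (h : z ∈ L.lattice) : AlgLog L z := Or.inl h

/-- [folklore] -/
theorem IsAlgPt.algLog {z : ℂ} (h : IsAlgPt L z) : AlgLog L z := Or.inr h

/-- [folklore] -/
theorem algLog_zero : AlgLog L 0 := algLog_of_mem (zero_mem _)

/-- Algebraic logarithms are closed under negation. [folklore] -/
theorem AlgLog.neg {z : ℂ} (h : AlgLog L z) : AlgLog L (-z) := by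
  rcases h with h | h
  · exact algLog_of_mem (neg_mem h)
  · exact h.neg.algLog

variable (L) in
/-- **Algebraic logarithms are closed under addition** (periodicity, the chord law
`IsAlgPt.add_of_ne`, and the tangent law `IsAlgPt.two_mul` when `z ≡ w`). [folklore] -/
theorem AlgLog.add (h₂ : IsAlgebraic ℚ L.g₂) {z w : ℂ} (hz : AlgLog L z) (hw : AlgLog L w) :
    AlgLog L (z + w) := by
  rcases hz with hz | hz
  · rcases hw with hw | hw
    · exact algLog_of_mem (add_mem hz hw)
    · rw [add_comm]; exact (hw.add_of_mem hz).algLog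
  · rcases hw with hw | hw
    · exact (hz.add_of_mem hw).algLog
    · by_cases hne : ℘[L] z = ℘[L] w
      · rcases (L.weierstrassP_eq_weierstrassP_iff hz.1 hw.1).1 hne with h | h
        · exact algLog_of_mem h
        · -- `z ≡ w`: `z + w = 2w + (z − w)`
          by_cases h2 : 2 * w ∈ L.lattice
          · have e : z + w = 2 * w + (z - w) := by ring
            rw [e]
            exact algLog_of_mem (add_mem h2 h)
          · have e : z + w = 2 * w + (z - w) := by ring
            rw [e]
            exact ((IsAlgPt.two_mul L h₂ hw h2).add_of_mem h).algLog
      · exact (IsAlgPt.add_of_ne L hz hw hne).algLog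

variable (L) in
/-- [folklore] -/
theorem AlgLog.sub (h₂ : IsAlgebraic ℚ L.g₂) {z w : ℂ} (hz : AlgLog L z) (hw : AlgLog L w) :
    AlgLog L (z - w) := by
  rw [sub_eq_add_neg]; exact hz.add L h₂ hw.neg

variable (L) in
/-- [folklore] -/
theorem AlgLog.nsmul (h₂ : IsAlgebraic ℚ L.g₂) {z : ℂ} (hz : AlgLog L z) (n : ℕ) :
    AlgLog L ((n : ℂ) * z) := by
  induction n with
  | zero => simpa using (algLog_zero (L := L))
  | succ n ih =>
    have e : ((n + 1 : ℕ) : ℂ) * z = (n : ℂ) * z + z := by push_cast; ring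
    rw [e]; exact ih.add L h₂ hz

variable (L) in
/-- [folklore] -/
theorem AlgLog.zsmul (h₂ : IsAlgebraic ℚ L.g₂) {z : ℂ} (hz : AlgLog L z) (n : ℤ) :
    AlgLog L ((n : ℂ) * z) := by
  obtain ⟨m, rfl | rfl⟩ := Int.eq_nat_or_neg n
  · simpa using hz.nsmul L h₂ m
  · have e : ((-(m : ℤ) : ℤ) : ℂ) * z = -((m : ℂ) * z) := by push_cast; ring
    rw [e]; exact (hz.nsmul L h₂ m).neg

variable (L) in
/-- [folklore] -/
theorem AlgLog.sum (h₂ : IsAlgebraic ℚ L.g₂) {ι : Type*} (s : Finset ι) (f : ι → ℂ)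
    (hf : ∀ i ∈ s, AlgLog L (f i)) : AlgLog L (∑ i ∈ s, f i) := by
  classical
  induction s using Finset.induction_on with
  | empty => simpa using (algLog_zero (L := L))
  | insert a s ha ih =>
    rw [Finset.sum_insert ha]
    exact (hf a (Finset.mem_insert_self a s)).add L h₂
      (ih fun i hi => hf i (Finset.mem_insert_of_mem hi))

/-! ### Generic algebraic base points -/

variable (L)

/-- A real combination `x ω₁ + y ω₂` lies in `Λ` only for integers `x, y`. [folklore] -/
theorem int_of_mem_lattice {x y : ℝ} (h : (x : ℂ) * L.ω₁ + (y : ℂ) * L.ω₂ ∈ L.lattice) :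
    (∃ m : ℤ, x = m) ∧ (∃ n : ℤ, y = n) := by
  obtain ⟨m, n, hmn⟩ := PeriodPair.mem_lattice.1 h
  have h0 := LinearIndependent.pair_iff.mp L.indep (x - m) (y - n) (by
    simp only [Complex.real_smul, Complex.ofReal_sub, Complex.ofReal_intCast]
    linear_combination -hmn)
  exact ⟨⟨m, by linarith [h0.1]⟩, ⟨n, by linarith [h0.2]⟩⟩

/-- **Generic algebraic points exist**: for every finite `B ⊂ ℂ` there is an algebraic point
`φ(t₀)` (a torsion point, a vertex of a torsion grid `G_k`) with `t₀ ∉ b + Λ` for all `b ∈ B`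
(pigeonhole: the `4ᵏ` vertices of `G_k` in a fundamental domain are pairwise incongruent).
[folklore] -/
theorem exists_generic_algPt (h₂ : IsAlgebraic ℚ L.g₂) (h₃ : IsAlgebraic ℚ L.g₃) (B : Finset ℂ) :
    ∃ t₀ : ℂ, IsAlgPt L t₀ ∧ ∀ b ∈ B, t₀ - b ∉ L.lattice := by
  classical
  obtain ⟨k, hk⟩ := pow_unbounded_of_one_lt (B.card : ℝ) (by norm_num : (1 : ℝ) < 4)
  have hk' : B.card < 4 ^ k := by exact_mod_cast hk
  set box : Finset (ℤ × ℤ) := (Finset.range (2 ^ k)).image (fun i : ℕ => (i : ℤ)) ×ˢ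
    (Finset.range (2 ^ k)).image (fun i : ℕ => (i : ℤ)) with hbox
  have hcard : box.card = 4 ^ k := by
    rw [hbox, Finset.card_product, Finset.card_image_of_injective _ Nat.cast_injective,
      Finset.card_range]
    rw [show (4 : ℕ) = 2 * 2 by norm_num, mul_pow]
  by_contra hcon
  push Not at hcon
  -- every vertex of the box is congruent to some `b ∈ B`
  have hall : ∀ μ ∈ box, ∃ b ∈ B, vtx L k μ - b ∈ L.lattice := fun μ _ => by
    obtain ⟨b, hb, h⟩ := hcon (vtx L k μ) (isAlgPt_vtx L h₂ h₃ k μ)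
    exact ⟨b, hb, h⟩
  choose! f hfB hf using hall
  obtain ⟨μ, hμ, μ', hμ', hne, heq⟩ := Finset.exists_ne_map_eq_of_card_lt_of_maps_to
    (by rw [hcard]; exact hk') hfB
  have hdiff : vtx L k μ - vtx L k μ' ∈ L.lattice := by
    have e : vtx L k μ - vtx L k μ' = (vtx L k μ - f μ) - (vtx L k μ' - f μ') := by rw [heq]; ring
    rw [e]
    exact sub_mem (hf μ hμ) (hf μ' hμ')
  rw [vtx_sub_vtx] at hdiff
  obtain ⟨⟨m, hm⟩, ⟨n, hn⟩⟩ := int_of_mem_lattice L hdiff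
  -- `(μ.1 − μ'.1)/2ᵏ = m ∈ ℤ` with `|μ.1 − μ'.1| < 2ᵏ` forces equality
  have hbound : ∀ {p q : ℤ}, (p, q) ∈ box → 0 ≤ p ∧ p < 2 ^ k ∧ 0 ≤ q ∧ q < 2 ^ k := by
    intro p q h
    rw [hbox, Finset.mem_product, Finset.mem_image, Finset.mem_image] at h
    obtain ⟨⟨i, hi, rfl⟩, ⟨j, hj, rfl⟩⟩ := h
    rw [Finset.mem_range] at hi hj
    exact ⟨by positivity, by exact_mod_cast hi, by positivity, by exact_mod_cast hj⟩
  have h2k : (0 : ℝ) < 2 ^ k := by positivity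
  have key : ∀ {p p' : ℤ} {m : ℤ}, ((p - p' : ℤ) / 2 ^ k : ℝ) = m → 0 ≤ p → p < 2 ^ k → 0 ≤ p' →
      p' < 2 ^ k → p = p' := by
    intro p p' m h hp hp' hq hq'
    have h' : ((p - p' : ℤ) : ℝ) = m * 2 ^ k := by rw [← h]; field_simp
    have hint : p - p' = m * 2 ^ k := by exact_mod_cast h'
    have h2 : (0 : ℤ) < 2 ^ k := by positivity
    rcases lt_trichotomy m 0 with hm | hm | hm
    · have hm' : m ≤ -1 := by omega
      nlinarith
    · rw [hm, zero_mul, sub_eq_zero] at hint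
      exact hint
    · have hm' : 1 ≤ m := by omega
      nlinarith
  obtain ⟨hμ1, hμ1', hμ2, hμ2'⟩ := hbound (p := μ.1) (q := μ.2) hμ
  obtain ⟨hν1, hν1', hν2, hν2'⟩ := hbound (p := μ'.1) (q := μ'.2) hμ'
  have e1 : μ.1 = μ'.1 := by
    refine key (m := m) ?_ hμ1 hμ1' hν1 hν1'
    have := hm
    simpa using this
  have e2 : μ.2 = μ'.2 := by
    refine key (m := n) ?_ hμ2 hμ2' hν2 hν2'
    simpa using hn
  exact hne (Prod.ext e1 e2)

/-! ### ℤ-linearity of the lifted symbols `U(w) = Sym(t₀ ↝ t₀ + w)` at a generic base point -/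

section Linearity

variable {L}
variable (h₂ : IsAlgebraic ℚ L.g₂) (h₃ : IsAlgebraic ℚ L.g₃)

local notation3 "S₀[" D "]" => LiftData.sym h₂ h₃ D (theta0 L) (hasAlgCoeffs_theta0 L h₂ h₃)
local notation3 "S₁[" D "]" => LiftData.sym h₂ h₃ D (theta1 L) (hasAlgCoeffs_theta1 L h₂ h₃)
local notation3 "𝟙" => (Finsupp.single PeriodSymbol.unit (1 : ℂ) : PeriodSymbol →₀ ℂ)

include h₂ h₃

omit h₂ h₃ in
/-- `t₀ + w ∉ Λ` from genericity against `−w`. [folklore] -/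
theorem notMem_of_generic {t₀ w : ℂ} {B : Finset ℂ} (hgen : ∀ b ∈ B, t₀ - b ∉ L.lattice)
    (h : -w ∈ B) : t₀ + w ∉ L.lattice := by
  simpa using hgen (-w) h

omit h₂ h₃ in
/-- `t₀ − w ∉ Λ` from genericity against `w`. [folklore] -/
theorem sub_notMem_of_generic {t₀ w : ℂ} {B : Finset ℂ} (hgen : ∀ b ∈ B, t₀ - b ∉ L.lattice)
    (h : w ∈ B) : t₀ - w ∉ L.lattice :=
  hgen w h

/-- **`U(0) ∼ 0`**: a lift from `t₀` to `t₀` has symbol in the span. [folklore] -/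
theorem zzero {t₀ b : ℂ} (hb : b = t₀) (D : LiftData L t₀ b)
    (ω : Fin 2 → MvPolynomial (Fin 2) ℂ) (hω : ∀ k, HasAlgCoeffs (ω k)) :
    InSpan (D.sym h₂ h₃ ω hω) := by
  subst hb
  exact LiftData.span_self h₂ h₃ D ω hω

/-- **Additivity `U(w + w′) ∼ U(w) + U(w′)` at a generic base point.** For algebraic logarithms
`w, w′` there is a finite set `B` such that for every algebraic base point `t₀ ∉ B + Λ` and all
lifts `D : t₀ ↝ t₀ + (w + w′)`, `D₁ : t₀ ↝ t₀ + w`, `D₂ : t₀ ↝ t₀ + w′`: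
`S₀[D] − S₀[D₁] − S₀[D₂]` and `S₁[D] − S₁[D₁] − S₁[D₂] − c·𝟙` (`c ∈ ℚ̄`) lie in the span —
additivity of lifted symbols plus translation by `w` (a lattice shift if `w ∈ Λ`).
[cite: HuberWustholz2022, §13.1 (B) (p. 120), §3.3.1 (pp. 42–44)] -/
theorem zadd {w w' : ℂ} (hw : AlgLog L w) (hw' : AlgLog L w') :
    ∃ B : Finset ℂ, ∀ t₀ : ℂ, IsAlgPt L t₀ → (∀ b ∈ B, t₀ - b ∉ L.lattice) →
      IsAlgPt L (t₀ + w) ∧ IsAlgPt L (t₀ + w') ∧ IsAlgPt L (t₀ + (w + w')) ∧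
      ∀ (D : LiftData L t₀ (t₀ + (w + w'))) (D₁ : LiftData L t₀ (t₀ + w))
        (D₂ : LiftData L t₀ (t₀ + w')),
        InSpan (S₀[D] - S₀[D₁] - S₀[D₂]) ∧
        ∃ c : ℂ, IsAlgebraic ℚ c ∧ InSpan (S₁[D] - S₁[D₁] - S₁[D₂] - c • 𝟙) := by
  classical
  refine ⟨{-w, -w', -(w + w'), w, w - w'}, fun t₀ ht₀ hgen => ?_⟩
  have hb1 : t₀ + w ∉ L.lattice := notMem_of_generic hgen (by simp)
  have hb2 : t₀ + w' ∉ L.lattice := notMem_of_generic hgen (by simp)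
  have hb12 : t₀ + (w + w') ∉ L.lattice := notMem_of_generic hgen (by simp)
  have h1 : IsAlgPt L (t₀ + w) := (ht₀.algLog.add L h₂ hw).isAlgPt hb1
  have h2' : IsAlgPt L (t₀ + w') := (ht₀.algLog.add L h₂ hw').isAlgPt hb2
  have h12 : IsAlgPt L (t₀ + (w + w')) := (ht₀.algLog.add L h₂ (hw.add L h₂ hw')).isAlgPt hb12
  refine ⟨h1, h2', h12, fun D D₁ D₂ => ?_⟩
  obtain ⟨Dm⟩ := LiftData.nonempty (L := L) (a := t₀ + w) (b := t₀ + (w + w')) h1 h12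
  have radd := fun (ω : Fin 2 → MvPolynomial (Fin 2) ℂ) (hω : ∀ k, HasAlgCoeffs (ω k)) =>
    LiftData.span_add h₂ h₃ D D₁ Dm ω hω
  by_cases hwΛ : w ∈ L.lattice
  · -- `w ∈ Λ`: `Dm` is a lattice shift of `D₂`
    have hsh := fun (ω : Fin 2 → MvPolynomial (Fin 2) ℂ) (hω : ∀ k, HasAlgCoeffs (ω k)) =>
      LiftData.span_sub_of_mem h₂ h₃ D₂ hwΛ (Dm.cast rfl (by ring)) ω hω
    refine ⟨?_, 0, isAlgebraic_zero, ?_⟩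
    · obtain ⟨K, ρ, cf, hρ, hcf, hsum⟩ := span_add (radd _ (hasAlgCoeffs_theta0 L h₂ h₃))
        (hsh _ (hasAlgCoeffs_theta0 L h₂ h₃))
      refine ⟨K, ρ, cf, hρ, hcf, ?_⟩
      rw [← hsum, LiftData.sym_cast]
      abel
    · obtain ⟨K, ρ, cf, hρ, hcf, hsum⟩ := span_add (radd _ (hasAlgCoeffs_theta1 L h₂ h₃))
        (hsh _ (hasAlgCoeffs_theta1 L h₂ h₃))
      refine ⟨K, ρ, cf, hρ, hcf, ?_⟩
      rw [← hsum, LiftData.sym_cast, zero_smul, sub_zero]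
      abel
  · -- `w ∉ Λ`: translate `D₂` by the algebraic point `φ(w)`
    have hwalg : IsAlgPt L w := hw.isAlgPt hwΛ
    have hne0 : ℘[L] t₀ ≠ ℘[L] w :=
      (weierstrassP_ne_iff L ht₀.1 hwΛ).2 ⟨hb1, sub_notMem_of_generic hgen (by simp)⟩
    have hne1 : ℘[L] (t₀ + w') ≠ ℘[L] w := by
      refine (weierstrassP_ne_iff L h2'.1 hwΛ).2 ⟨?_, ?_⟩
      · have e : t₀ + w' + w = t₀ + (w + w') := by ring
        rw [e]; exact hb12
      · have h := sub_notMem_of_generic hgen (show w - w' ∈ _ by simp)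
        have e : t₀ - (w - w') = t₀ + w' - w := by ring
        rwa [e] at h
    have ht0 := LiftData.span_translate_theta0 h₂ h₃ hwalg D₂ (Dm.cast rfl (by ring)) hne0 hne1
    have ht1 := LiftData.span_translate_theta1 h₂ h₃ hwalg D₂ (Dm.cast rfl (by ring)) hne0 hne1
    rw [LiftData.sym_cast] at ht0 ht1
    refine ⟨?_, eval (psiT L w (t₀ + w')) (rPolyT L w) - eval (psiT L w t₀) (rPolyT L w),
      isAlgebraic_translate_const L hwalg ht₀ h2', ?_⟩
    · obtain ⟨K, ρ, cf, hρ, hcf, hsum⟩ := span_add (radd _ (hasAlgCoeffs_theta0 L h₂ h₃)) ht0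
      exact ⟨K, ρ, cf, hρ, hcf, by rw [← hsum]; abel⟩
    · obtain ⟨K, ρ, cf, hρ, hcf, hsum⟩ := span_add (radd _ (hasAlgCoeffs_theta1 L h₂ h₃)) ht1
      exact ⟨K, ρ, cf, hρ, hcf, by rw [← hsum]; abel⟩

/-- **`U(−m) ∼ −U(m)`** at a generic base point (up to an algebraic constant for `θ₁`).
[folklore] -/
theorem zneg {m : ℂ} (hm : AlgLog L m) :
    ∃ B : Finset ℂ, ∀ t₀ : ℂ, IsAlgPt L t₀ → (∀ b ∈ B, t₀ - b ∉ L.lattice) →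
      IsAlgPt L (t₀ + m) ∧ IsAlgPt L (t₀ + -m) ∧
      ∀ (D : LiftData L t₀ (t₀ + -m)) (D₁ : LiftData L t₀ (t₀ + m)),
        InSpan (S₀[D] + S₀[D₁]) ∧
        ∃ c : ℂ, IsAlgebraic ℚ c ∧ InSpan (S₁[D] + S₁[D₁] - c • 𝟙) := by
  obtain ⟨B, hB⟩ := zadd h₂ h₃ hm hm.neg
  refine ⟨B, fun t₀ ht₀ hgen => ?_⟩
  obtain ⟨h1, h2', h12, hall⟩ := hB t₀ ht₀ hgen
  refine ⟨h1, h2', fun D D₁ => ?_⟩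
  obtain ⟨D₀⟩ := LiftData.nonempty (L := L) (a := t₀) (b := t₀ + (m + -m)) ht₀ h12
  obtain ⟨r0, c, hc, r1⟩ := hall D₀ D₁ D
  have hz : t₀ + (m + -m) = t₀ := by ring
  have z0 := zzero h₂ h₃ hz D₀ (theta0 L) (hasAlgCoeffs_theta0 L h₂ h₃)
  have z1 := zzero h₂ h₃ hz D₀ (theta1 L) (hasAlgCoeffs_theta1 L h₂ h₃)
  refine ⟨?_, -c, hc.neg, ?_⟩
  · obtain ⟨K, ρ, cf, hρ, hcf, hsum⟩ := span_sub z0 r0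
    exact ⟨K, ρ, cf, hρ, hcf, by rw [← hsum]; abel⟩
  · obtain ⟨K, ρ, cf, hρ, hcf, hsum⟩ := span_sub z1 r1
    exact ⟨K, ρ, cf, hρ, hcf, by rw [← hsum, neg_smul]; abel⟩

/-- **`U(n·m) ∼ n·U(m)`** for `n ∈ ℕ` at a generic base point. [folklore] -/
theorem znsmul {m : ℂ} (hm : AlgLog L m) (n : ℕ) :
    ∃ B : Finset ℂ, ∀ t₀ : ℂ, IsAlgPt L t₀ → (∀ b ∈ B, t₀ - b ∉ L.lattice) →
      IsAlgPt L (t₀ + m) ∧ IsAlgPt L (t₀ + (n : ℂ) * m) ∧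
      ∀ (D : LiftData L t₀ (t₀ + (n : ℂ) * m)) (D₁ : LiftData L t₀ (t₀ + m)),
        InSpan (S₀[D] - (n : ℂ) • S₀[D₁]) ∧
        ∃ c : ℂ, IsAlgebraic ℚ c ∧ InSpan (S₁[D] - (n : ℂ) • S₁[D₁] - c • 𝟙) := by
  classical
  induction n with
  | zero =>
    refine ⟨{-m}, fun t₀ ht₀ hgen => ?_⟩
    have h1 : IsAlgPt L (t₀ + m) :=
      (ht₀.algLog.add L h₂ hm).isAlgPt (notMem_of_generic hgen (by simp))
    have hz : t₀ + ((0 : ℕ) : ℂ) * m = t₀ := by simp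
    refine ⟨h1, by rw [hz]; exact ht₀, fun D D₁ => ⟨?_, 0, isAlgebraic_zero, ?_⟩⟩
    · simpa using zzero h₂ h₃ hz D (theta0 L) (hasAlgCoeffs_theta0 L h₂ h₃)
    · simpa using zzero h₂ h₃ hz D (theta1 L) (hasAlgCoeffs_theta1 L h₂ h₃)
  | succ n ih =>
    obtain ⟨B₁, hB₁⟩ := ih
    obtain ⟨B₂, hB₂⟩ := zadd h₂ h₃ (hm.nsmul L h₂ n) hm
    refine ⟨B₁ ∪ B₂, fun t₀ ht₀ hgen => ?_⟩
    have hg₁ : ∀ b ∈ B₁, t₀ - b ∉ L.lattice := fun b hb => hgen b (Finset.mem_union_left _ hb)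
    have hg₂ : ∀ b ∈ B₂, t₀ - b ∉ L.lattice := fun b hb => hgen b (Finset.mem_union_right _ hb)
    obtain ⟨h1, hn, hall₁⟩ := hB₁ t₀ ht₀ hg₁
    obtain ⟨hn', _, hn1, hall₂⟩ := hB₂ t₀ ht₀ hg₂
    have e : t₀ + ((n + 1 : ℕ) : ℂ) * m = t₀ + ((n : ℂ) * m + m) := by push_cast; ring
    refine ⟨h1, by rw [e]; exact hn1, fun D D₁ => ?_⟩
    obtain ⟨Dn⟩ := LiftData.nonempty (L := L) (a := t₀) (b := t₀ + (n : ℂ) * m) ht₀ hn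
    obtain ⟨ra0, c, hc, ra1⟩ := hall₂ (D.cast rfl e) Dn D₁
    obtain ⟨ri0, c', hc', ri1⟩ := hall₁ Dn D₁
    rw [LiftData.sym_cast] at ra0 ra1
    refine ⟨?_, c + c', hc.add hc', ?_⟩
    · obtain ⟨K, ρ, cf, hρ, hcf, hsum⟩ := span_add ra0 ri0
      refine ⟨K, ρ, cf, hρ, hcf, ?_⟩
      rw [← hsum]
      push_cast
      rw [add_smul, one_smul]
      abel
    · obtain ⟨K, ρ, cf, hρ, hcf, hsum⟩ := span_add ra1 ri1
      refine ⟨K, ρ, cf, hρ, hcf, ?_⟩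
      rw [← hsum]
      push_cast
      rw [add_smul, one_smul, add_smul]
      abel

/-- **`U(z·m) ∼ z·U(m)`** for `z ∈ ℤ` at a generic base point. [folklore] -/
theorem zzsmul {m : ℂ} (hm : AlgLog L m) (z : ℤ) :
    ∃ B : Finset ℂ, ∀ t₀ : ℂ, IsAlgPt L t₀ → (∀ b ∈ B, t₀ - b ∉ L.lattice) →
      IsAlgPt L (t₀ + m) ∧ IsAlgPt L (t₀ + (z : ℂ) * m) ∧
      ∀ (D : LiftData L t₀ (t₀ + (z : ℂ) * m)) (D₁ : LiftData L t₀ (t₀ + m)),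
        InSpan (S₀[D] - (z : ℂ) • S₀[D₁]) ∧
        ∃ c : ℂ, IsAlgebraic ℚ c ∧ InSpan (S₁[D] - (z : ℂ) • S₁[D₁] - c • 𝟙) := by
  classical
  obtain ⟨n, rfl | rfl⟩ := Int.eq_nat_or_neg z
  · obtain ⟨B, hB⟩ := znsmul h₂ h₃ hm n
    refine ⟨B, fun t₀ ht₀ hgen => ?_⟩
    obtain ⟨h1, hn, hall⟩ := hB t₀ ht₀ hgen
    have e : ((n : ℤ) : ℂ) = (n : ℂ) := by simp
    refine ⟨h1, by rw [e]; exact hn, fun D D₁ => ?_⟩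
    obtain ⟨r0, c, hc, r1⟩ := hall (D.cast rfl (by rw [e])) D₁
    rw [LiftData.sym_cast] at r0 r1
    exact ⟨by simpa only [e] using r0, c, hc, by simpa only [e] using r1⟩
  · -- `z = −n`: `U(n·(−m)) ∼ n·U(−m) ∼ −n·U(m)`
    obtain ⟨B₁, hB₁⟩ := znsmul h₂ h₃ hm.neg n
    obtain ⟨B₂, hB₂⟩ := zneg h₂ h₃ hm
    refine ⟨B₁ ∪ B₂, fun t₀ ht₀ hgen => ?_⟩
    have hg₁ : ∀ b ∈ B₁, t₀ - b ∉ L.lattice := fun b hb => hgen b (Finset.mem_union_left _ hb)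
    have hg₂ : ∀ b ∈ B₂, t₀ - b ∉ L.lattice := fun b hb => hgen b (Finset.mem_union_right _ hb)
    obtain ⟨hneg, hn, hall₁⟩ := hB₁ t₀ ht₀ hg₁
    obtain ⟨h1, _, hall₂⟩ := hB₂ t₀ ht₀ hg₂
    have e : t₀ + ((-(n : ℤ) : ℤ) : ℂ) * m = t₀ + (n : ℂ) * -m := by push_cast; ring
    refine ⟨h1, by rw [e]; exact hn, fun D D₁ => ?_⟩
    obtain ⟨Dneg⟩ := LiftData.nonempty (L := L) (a := t₀) (b := t₀ + -m) ht₀ hneg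
    obtain ⟨r0, c, hc, r1⟩ := hall₁ (D.cast rfl e) Dneg
    obtain ⟨s0, c', hc', s1⟩ := hall₂ Dneg D₁
    rw [LiftData.sym_cast] at r0 r1
    have hnalg : IsAlgebraic ℚ (n : ℂ) := isAlgebraic_nat n
    refine ⟨?_, c + n * c', hc.add (hnalg.mul hc'), ?_⟩
    · obtain ⟨K, ρ, cf, hρ, hcf, hsum⟩ := span_add r0 (span_smul hnalg s0)
      refine ⟨K, ρ, cf, hρ, hcf, ?_⟩
      rw [← hsum]
      push_cast
      simp only [smul_add, neg_smul]
      abel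
    · obtain ⟨K, ρ, cf, hρ, hcf, hsum⟩ := span_add r1 (span_smul hnalg s1)
      refine ⟨K, ρ, cf, hρ, hcf, ?_⟩
      rw [← hsum]
      push_cast
      simp only [smul_sub, smul_add, neg_smul, add_smul, smul_smul]
      abel

/-- **ℤ-linear expansion `U(Σ n_l m_l) ∼ Σ n_l U(m_l)`** at a generic base point: for algebraic
logarithms `m_l` and integers `n_l` there is a finite `B` such that for every algebraic
`t₀ ∉ B + Λ` and all lifts `D : t₀ ↝ t₀ + Σ n_l m_l`, `D_l : t₀ ↝ t₀ + m_l`,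
`S₀[D] − Σ n_l S₀[D_l]` and `S₁[D] − Σ n_l S₁[D_l] − c·𝟙` (`c ∈ ℚ̄`) lie in the span.
[cite: HuberWustholz2022, §13.1 (B) (p. 120), §3.3.1 (pp. 42–44)] -/
theorem zexpand (r : ℕ) : ∀ (m : Fin r → ℂ) (_hm : ∀ l, AlgLog L (m l)) (n : Fin r → ℤ),
    ∃ B : Finset ℂ, ∀ t₀ : ℂ, IsAlgPt L t₀ → (∀ b ∈ B, t₀ - b ∉ L.lattice) →
      (∀ l, IsAlgPt L (t₀ + m l)) ∧ IsAlgPt L (t₀ + ∑ l, (n l : ℂ) * m l) ∧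
      ∀ (D : LiftData L t₀ (t₀ + ∑ l, (n l : ℂ) * m l)) (D₁ : ∀ l, LiftData L t₀ (t₀ + m l)),
        InSpan (S₀[D] - ∑ l, (n l : ℂ) • S₀[D₁ l]) ∧
        ∃ c : ℂ, IsAlgebraic ℚ c ∧ InSpan (S₁[D] - ∑ l, (n l : ℂ) • S₁[D₁ l] - c • 𝟙) := by
  classical
  induction r with
  | zero =>
    intro m _ n
    refine ⟨∅, fun t₀ ht₀ _ => ⟨fun l => l.elim0, by simpa using ht₀, fun D D₁ => ?_⟩⟩
    have hz : t₀ + ∑ l : Fin 0, (n l : ℂ) * m l = t₀ := by simp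
    refine ⟨?_, 0, isAlgebraic_zero, ?_⟩
    · simpa using zzero h₂ h₃ hz D (theta0 L) (hasAlgCoeffs_theta0 L h₂ h₃)
    · simpa using zzero h₂ h₃ hz D (theta1 L) (hasAlgCoeffs_theta1 L h₂ h₃)
  | succ r ih =>
    intro m hm n
    set w : ℂ := ∑ l : Fin r, (n (Fin.castSucc l) : ℂ) * m (Fin.castSucc l) with hw
    set w' : ℂ := (n (Fin.last r) : ℂ) * m (Fin.last r) with hw'
    have hwA : AlgLog L w := AlgLog.sum L h₂ _ _ fun l _ => (hm _).zsmul L h₂ _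
    have hw'A : AlgLog L w' := (hm _).zsmul L h₂ _
    obtain ⟨B₁, hB₁⟩ := ih (fun l => m (Fin.castSucc l)) (fun l => hm _) (fun l => n (Fin.castSucc l))
    obtain ⟨B₂, hB₂⟩ := zzsmul h₂ h₃ (hm (Fin.last r)) (n (Fin.last r))
    obtain ⟨B₃, hB₃⟩ := zadd h₂ h₃ hwA hw'A
    refine ⟨B₁ ∪ B₂ ∪ B₃, fun t₀ ht₀ hgen => ?_⟩
    have hg₁ : ∀ b ∈ B₁, t₀ - b ∉ L.lattice := fun b hb =>
      hgen b (Finset.mem_union_left _ (Finset.mem_union_left _ hb))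
    have hg₂ : ∀ b ∈ B₂, t₀ - b ∉ L.lattice := fun b hb =>
      hgen b (Finset.mem_union_left _ (Finset.mem_union_right _ hb))
    have hg₃ : ∀ b ∈ B₃, t₀ - b ∉ L.lattice := fun b hb => hgen b (Finset.mem_union_right _ hb)
    obtain ⟨hml, hw1, hall₁⟩ := hB₁ t₀ ht₀ hg₁
    obtain ⟨hmlast, hw'1, hall₂⟩ := hB₂ t₀ ht₀ hg₂
    obtain ⟨_, _, hww', hall₃⟩ := hB₃ t₀ ht₀ hg₃
    have e : t₀ + ∑ l : Fin (r + 1), (n l : ℂ) * m l = t₀ + (w + w') := by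
      rw [Fin.sum_univ_castSucc]
    refine ⟨fun l => ?_, by rw [e]; exact hww', fun D D₁ => ?_⟩
    · refine Fin.lastCases ?_ (fun l => ?_) l
      · exact hmlast
      · exact hml l
    obtain ⟨Dw⟩ := LiftData.nonempty (L := L) (a := t₀) (b := t₀ + w) ht₀ hw1
    obtain ⟨Dw'⟩ := LiftData.nonempty (L := L) (a := t₀) (b := t₀ + w') ht₀ hw'1
    obtain ⟨a0, c₁, hc₁, a1⟩ := hall₃ (D.cast rfl e) Dw Dw'
    obtain ⟨i0, c₂, hc₂, i1⟩ := hall₁ Dw fun l => D₁ (Fin.castSucc l)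
    obtain ⟨s0, c₃, hc₃, s1⟩ := hall₂ Dw' (D₁ (Fin.last r))
    rw [LiftData.sym_cast] at a0 a1
    refine ⟨?_, c₁ + c₂ + c₃, (hc₁.add hc₂).add hc₃, ?_⟩
    · obtain ⟨K, ρ, cf, hρ, hcf, hsum⟩ := span_add (span_add a0 i0) s0
      refine ⟨K, ρ, cf, hρ, hcf, ?_⟩
      rw [← hsum, Fin.sum_univ_castSucc (f := fun l =>
        (n l : ℂ) • LiftData.sym h₂ h₃ (D₁ l) (theta0 L) (hasAlgCoeffs_theta0 L h₂ h₃))]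
      abel
    · obtain ⟨K, ρ, cf, hρ, hcf, hsum⟩ := span_add (span_add a1 i1) s1
      refine ⟨K, ρ, cf, hρ, hcf, ?_⟩
      rw [← hsum, Fin.sum_univ_castSucc (f := fun l =>
        (n l : ℂ) • LiftData.sym h₂ h₃ (D₁ l) (theta1 L) (hasAlgCoeffs_theta1 L h₂ h₃)),
        add_smul, add_smul]
      abel

end Linearity

end Ell

end CurvePeriods

end Literature.NumberTheory.Transcendental

end
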